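import Summits.CriticalPhenomena.PercolationContinuityZ3.Theorems.Transplant.SkeletonFrmQuasiCustomersHolds
import Summits.CriticalPhenomena.PercolationContinuityZ3.Theorems.Transplant.Slab111OwnCriticalContinuityHolds
import Literature.Probability.Percolation.BoundedDegreeCriticalProb
import HarnessLib

/-!
# TARGET 2x BY NAME: the `(001)`-films of the DIAMOND lattice are connected (`k ≥ 2`) and die at their own critical points
# (`DiamondFilmOwnCriticalContinuity k`, every `k ≥ 2`), hence `ObliqueFilmOwnCriticalContinuity` — unconditionally

builds on p205010 (kernel theorem, internal audit signed; external expert review pending).  Lane `prim-bschramm`, seat `prim-bschramm-stmt`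
gen 36 (statements seat; by-name customer of the rung-Q node); helper file (`--supports stmt-CriticalPhenomena-4575 --as helper`); PROOFS ONLY (def-free).

THE POINT.  The `(001)`-film `D_k = {x ∈ diamond : 0 ≤ x₂ ≤ k}` of the diamond lattice (`diamondGraph.induce (diamondFilm k)`, «DiamondFilmNoSkeleton»;
the diamond structure in the bcc integer frame, «DiamondLattice») is a DOUBLY PERIODIC GRAPH: the translations `x ↦ x + (4m, 4n, 0)` preserve the
diamond parities (`x₀ ≡ x₁ ≡ x₂ (mod 2)`, `x₀ + x₁ + x₂ ≡ 0, 3 (mod 4)`) and the height `x₂`, act by graph automorphisms (coordinate differences are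
kept), FREELY, with finitely many orbits (representatives in the box `0 ≤ x₀, x₁ < 4`, `0 ≤ x₂ ≤ k`); and the film is CONNECTED for `k ≥ 2` (§2 — the
scope record «StatementObliqueFilms» listed as missing: from an even site the east/west bonds `(σ, σ, +1)` go up and the north/south bonds go down, from an
odd site the reverse, so inside three consecutive layers the ground level carries the moves `±(2, 2, 0)` AND `±(2, −2, 0)`, which generate the ground
lattice; with two layers only the diagonal moves survive and `D_1` falls apart into the zigzag lines `x₀ − x₁ = const`).  The rung-Q node
«SkelFrmQuasiProxHoldsAll» (p553137) through «SkeletonFrmQuasiCustomersHolds» §`AutChart.conj4_zTwoPeriodic_holds` therefore gives, for EVERY `k ≥ 2` and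
EVERY vertex `v` of `D_k`: **`p_c(v) < 1` and `θ_v(p_c(v)) = 0`** (`DiamondFilm.conj4_holds`), i.e. the `@[conjecture]` node **`DiamondFilmOwnCriticalContinuity k`**
(«StatementObliqueFilms» :50) for every `k ≥ 2`: **`diamondFilmOwnCriticalContinuity_holds (hk : 2 ≤ k)`** (`k = 1` is 2-regular with `p_c = 1`, excluded by
the target; `k = 0` is edgeless, `diamondFilmOwnCriticalContinuity_zero`).  Together with the `(111)`-films («Slab111OwnCriticalContinuityHolds»,
`slab111OwnCriticalContinuity_holds`, p559127) this is **TARGET 2x `ObliqueFilmOwnCriticalContinuity` BY NAME: `obliqueFilmOwnCriticalContinuity_holds`**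
(postcont-2 Targets §gen-51; «StatementObliqueFilms» :56) — no Trofimov hypothesis, no growth hypothesis, no named fact.  In print: the honeycomb film (`(111)`,
`k = 1`; Kesten 1982) and the diamond `k = 2` film (the once-subdivided square lattice — Harris–Kesten by an exact substitution); OPEN in print
before this file: `(111)` for `k ≥ 2` and diamond for `k ≥ 3`.  Nothing is claimed about films at the ambient lattice's
`p_c` (a different node) or about `BenjaminiSchramm1996_conj4` beyond these periodic instances.
* §1 bonds inside the film (`exists_adj_coe_eq`, `exists_adj_down`, `exists_reachable_height_zero`) and the two ground-level moves
  (`exists_reachable_diag`: `±(2,2,0)` through layer `1`; `exists_reachable_antidiag`: `±(2,−2,0)` through layers `1, 2`);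
* §2 **`DiamondFilm.connected (hk : 2 ≤ k)`** (ground-level descent on `max(|x₀|, |x₁|)`, `reachable_origin_of_height_zero`, `reachable_origin`);
* §3 the free cocompact `ℤ²`-action by `(4m, 4n, 0)` (`add_mem_diamondSite`, `add_mem_diamondFilm`, `finite_reps`) and **`DiamondFilm.conj4_holds`**,
  `DiamondFilm.criticalProb_lt_one`; the edgeless case `k = 0` (`not_adj_of_zero`, `theta_of_zero`);
* §4 the nodes by name: `diamondFilmOwnCriticalContinuity_holds`, `diamondFilmOwnCriticalContinuity_zero`, **`obliqueFilmOwnCriticalContinuity_holds`**.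
[cite: BenjaminiSchramm1996, Conj. 4 / Question 3; §2 (almost transitive graphs)] [cite: ConwaySloane1999, Ch. 4 §7.3 (D₃⁺ = diamond)]
[cite: Kesten1982, Ch. 3 (periodic graphs)] [cite: DuminilCopinSidoraviciusTassion2016, p. 3 "Two generalizations" (not covered there)]
-/

noncomputable section

namespace Summit.CriticalPhenomena.PercolationContinuityZ3.Theorems.Transplant

open SimpleGraph Literature.Barriers.CriticalPhenomena Literature.Probability.LatticeModels Literature.Probability.Percolation
open scoped Classical

namespace DiamondFilm

/-! ## §1 Bonds inside the film -/

/-- A diamond bond whose endpoint keeps `0 ≤ x₂ ≤ k` is an edge of the film (endpoint with its coordinates). [folklore] -/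
theorem exists_adj_coe_eq {k : ℕ} (x : diamondFilm k) (i : Fin 2) {σ : ℤ} (hσ : σ = 1 ∨ σ = -1)
    (h0 : 0 ≤ ((x : diamondSite) : Site 3) 2 + bondVec ((x : diamondSite) : Site 3) i σ 2)
    (hk : ((x : diamondSite) : Site 3) 2 + bondVec ((x : diamondSite) : Site 3) i σ 2 ≤ k) :
    ∃ y : diamondFilm k, (diamondGraph.induce (diamondFilm k)).Adj x y ∧
      ((y : diamondSite) : Site 3) = ((x : diamondSite) : Site 3) + bondVec ((x : diamondSite) : Site 3) i σ :=
  ⟨⟨bondEnd (x : diamondSite) i hσ, by rw [mem_diamondFilm, coe_bondEnd, Pi.add_apply]; exact ⟨h0, hk⟩⟩,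
    diamondGraph_adj_bondEnd _ i hσ, rfl⟩

/-- **One step down**: a film vertex at height `x₂ ≥ 1` has a film neighbour at height `x₂ − 1` (from an even site along a north/south bond,
from an odd site along an east/west bond). [cite: ConwaySloane1999, Ch. 4 §7.3] -/
theorem exists_adj_down {k : ℕ} (x : diamondFilm k) (h1 : 1 ≤ ((x : diamondSite) : Site 3) 2) :
    ∃ y : diamondFilm k, (diamondGraph.induce (diamondFilm k)).Adj x y ∧
      ((y : diamondSite) : Site 3) 2 = ((x : diamondSite) : Site 3) 2 - 1 := by
  have hx := mem_diamondFilm.1 x.2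
  rcases Int.emod_two_eq_zero_or_one (((x : diamondSite) : Site 3) 2) with he | ho
  · have h2 : bondVec ((x : diamondSite) : Site 3) 1 1 2 = -1 := by simp [bondVec_two, fibreSign, he]
    obtain ⟨y, hy, hc⟩ := exists_adj_coe_eq x 1 (σ := 1) (Or.inl rfl) (by rw [h2]; omega) (by rw [h2]; omega)
    exact ⟨y, hy, by rw [hc, Pi.add_apply, h2]; ring⟩
  · have h2 : bondVec ((x : diamondSite) : Site 3) 0 1 2 = -1 := by simp [bondVec_two, fibreSign, ho]
    obtain ⟨y, hy, hc⟩ := exists_adj_coe_eq x 0 (σ := 1) (Or.inl rfl) (by rw [h2]; omega) (by rw [h2]; omega)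
    exact ⟨y, hy, by rw [hc, Pi.add_apply, h2]; ring⟩

/-- **Down to the ground level**: every film vertex is joined inside the film to a vertex at height `0`. [folklore] -/
theorem exists_reachable_height_zero {k : ℕ} : ∀ (n : ℕ) (x : diamondFilm k), ((x : diamondSite) : Site 3) 2 ≤ n →
    ∃ y : diamondFilm k, ((y : diamondSite) : Site 3) 2 = 0 ∧ (diamondGraph.induce (diamondFilm k)).Reachable x y := by
  intro n
  induction n with
  | zero =>
    intro x hn
    exact ⟨x, le_antisymm (by exact_mod_cast hn) (mem_diamondFilm.1 x.2).1, Reachable.refl _⟩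
  | succ n ih =>
    intro x hn
    by_cases h0 : ((x : diamondSite) : Site 3) 2 = 0
    · exact ⟨x, h0, Reachable.refl _⟩
    · have hx := mem_diamondFilm.1 x.2
      obtain ⟨y, hy, hc⟩ := exists_adj_down x (by omega)
      obtain ⟨z, hz, hr⟩ := ih y (by push_cast at hn ⊢; omega)
      exact ⟨z, hz, hy.reachable.trans hr⟩

/-- **The diagonal move at ground level** (`k ≥ 1`): from `x` at height `0`, up along `(σ,σ,+1)` and down along `(σ,σ,−1)` reaches
`x + (2σ, 2σ, 0)` inside the film. [cite: ConwaySloane1999, Ch. 4 §7.3] -/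
theorem exists_reachable_diag {k : ℕ} (hk : 1 ≤ k) (x : diamondFilm k) (hx2 : ((x : diamondSite) : Site 3) 2 = 0) {σ : ℤ}
    (hσ : σ = 1 ∨ σ = -1) :
    ∃ z : diamondFilm k, (((z : diamondSite) : Site 3) 0 = ((x : diamondSite) : Site 3) 0 + 2 * σ ∧
      ((z : diamondSite) : Site 3) 1 = ((x : diamondSite) : Site 3) 1 + 2 * σ ∧ ((z : diamondSite) : Site 3) 2 = 0) ∧
      (diamondGraph.induce (diamondFilm k)).Reachable x z := by
  -- up along `(σ, σ, +1)` (even site, east/west bond)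
  have hb2 : bondVec ((x : diamondSite) : Site 3) 0 σ 2 = 1 := by simp [bondVec_two, fibreSign, hx2]
  obtain ⟨y, hxy, hyc⟩ := exists_adj_coe_eq x 0 hσ (by rw [hb2, hx2]; norm_num) (by rw [hb2, hx2]; exact_mod_cast hk)
  have hy0 : ((y : diamondSite) : Site 3) 0 = ((x : diamondSite) : Site 3) 0 + σ := by rw [hyc, Pi.add_apply, bondVec_zero]
  have hy1 : ((y : diamondSite) : Site 3) 1 = ((x : diamondSite) : Site 3) 1 + σ := by
    rw [hyc, Pi.add_apply, bondVec_one, if_pos rfl]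
  have hy2 : ((y : diamondSite) : Site 3) 2 = 1 := by rw [hyc, Pi.add_apply, hb2, hx2, zero_add]
  -- down along `(σ, σ, −1)` (odd site, east/west bond)
  have hc2 : bondVec ((y : diamondSite) : Site 3) 0 σ 2 = -1 := by simp [bondVec_two, fibreSign, hy2]
  obtain ⟨z, hyz, hzc⟩ := exists_adj_coe_eq y 0 hσ (by rw [hc2, hy2]; norm_num) (by rw [hc2, hy2]; simp)
  refine ⟨z, ⟨?_, ?_, ?_⟩, hxy.reachable.trans hyz.reachable⟩
  · rw [hzc, Pi.add_apply, bondVec_zero, hy0]; ring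
  · rw [hzc, Pi.add_apply, bondVec_one, if_pos rfl, hy1]; ring
  · rw [hzc, Pi.add_apply, hc2, hy2]; ring

/-- **The anti-diagonal move at ground level** (`k ≥ 2`): from `x` at height `0`, up `(1,1,+1)`, up `(τ,−τ,+1)`, down `(τ,−τ,−1)`,
down `(−1,−1,−1)` reaches `x + (2τ, −2τ, 0)` inside the film — the move that needs the THIRD layer (at `k = 1` the film falls apart
into the lines `x₀ − x₁ = const`). [cite: ConwaySloane1999, Ch. 4 §7.3] -/
theorem exists_reachable_antidiag {k : ℕ} (hk : 2 ≤ k) (x : diamondFilm k) (hx2 : ((x : diamondSite) : Site 3) 2 = 0) {τ : ℤ}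
    (hτ : τ = 1 ∨ τ = -1) :
    ∃ z : diamondFilm k, (((z : diamondSite) : Site 3) 0 = ((x : diamondSite) : Site 3) 0 + 2 * τ ∧
      ((z : diamondSite) : Site 3) 1 = ((x : diamondSite) : Site 3) 1 - 2 * τ ∧ ((z : diamondSite) : Site 3) 2 = 0) ∧
      (diamondGraph.induce (diamondFilm k)).Reachable x z := by
  -- up along `(1, 1, +1)`
  have hb2 : bondVec ((x : diamondSite) : Site 3) 0 1 2 = 1 := by simp [bondVec_two, fibreSign, hx2]
  obtain ⟨y, hxy, hyc⟩ := exists_adj_coe_eq x 0 (σ := 1) (Or.inl rfl) (by rw [hb2, hx2]; norm_num) (by rw [hb2, hx2]; omega)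
  have hy0 : ((y : diamondSite) : Site 3) 0 = ((x : diamondSite) : Site 3) 0 + 1 := by rw [hyc, Pi.add_apply, bondVec_zero]
  have hy1 : ((y : diamondSite) : Site 3) 1 = ((x : diamondSite) : Site 3) 1 + 1 := by
    rw [hyc, Pi.add_apply, bondVec_one, if_pos rfl]
  have hy2 : ((y : diamondSite) : Site 3) 2 = 1 := by rw [hyc, Pi.add_apply, hb2, hx2, zero_add]
  -- up along `(τ, −τ, +1)` (odd site, north/south bond)
  have hc2 : bondVec ((y : diamondSite) : Site 3) 1 τ 2 = 1 := by simp [bondVec_two, fibreSign, hy2]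
  obtain ⟨u, hyu, huc⟩ := exists_adj_coe_eq y 1 hτ (by rw [hc2, hy2]; norm_num) (by rw [hc2, hy2]; omega)
  have hu0 : ((u : diamondSite) : Site 3) 0 = ((x : diamondSite) : Site 3) 0 + 1 + τ := by rw [huc, Pi.add_apply, bondVec_zero, hy0]
  have hu1 : ((u : diamondSite) : Site 3) 1 = ((x : diamondSite) : Site 3) 1 + 1 - τ := by
    rw [huc, Pi.add_apply, bondVec_one, if_neg (by decide), hy1]; ring
  have hu2 : ((u : diamondSite) : Site 3) 2 = 2 := by rw [huc, Pi.add_apply, hc2, hy2]; ring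
  -- down along `(τ, −τ, −1)` (even site, north/south bond)
  have hd2 : bondVec ((u : diamondSite) : Site 3) 1 τ 2 = -1 := by simp [bondVec_two, fibreSign, hu2]
  obtain ⟨w, huw, hwc⟩ := exists_adj_coe_eq u 1 hτ (by rw [hd2, hu2]; norm_num) (by rw [hd2, hu2]; omega)
  have hw0 : ((w : diamondSite) : Site 3) 0 = ((x : diamondSite) : Site 3) 0 + 1 + 2 * τ := by
    rw [hwc, Pi.add_apply, bondVec_zero, hu0]; ring
  have hw1 : ((w : diamondSite) : Site 3) 1 = ((x : diamondSite) : Site 3) 1 + 1 - 2 * τ := by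
    rw [hwc, Pi.add_apply, bondVec_one, if_neg (by decide), hu1]; ring
  have hw2 : ((w : diamondSite) : Site 3) 2 = 1 := by rw [hwc, Pi.add_apply, hd2, hu2]; ring
  -- down along `(−1, −1, −1)` (odd site, east/west bond)
  have he2 : bondVec ((w : diamondSite) : Site 3) 0 (-1) 2 = -1 := by simp [bondVec_two, fibreSign, hw2]
  obtain ⟨z, hwz, hzc⟩ := exists_adj_coe_eq w 0 (σ := -1) (Or.inr rfl) (by rw [he2, hw2]; norm_num) (by rw [he2, hw2]; simp)
  refine ⟨z, ⟨?_, ?_, ?_⟩, hxy.reachable.trans (hyu.reachable.trans (huw.reachable.trans hwz.reachable))⟩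
  · rw [hzc, Pi.add_apply, bondVec_zero, hw0]; ring
  · rw [hzc, Pi.add_apply, bondVec_one, if_pos rfl, hw1]; ring
  · rw [hzc, Pi.add_apply, he2, hw2]; ring

/-! ## §2 Connectedness of the film for `k ≥ 2` -/

/-- **Ground-level descent**: every film vertex at height `0` with `|x₀|, |x₁| ≤ n` is joined inside the film to the origin (`k ≥ 2`;
strong induction on `n`, each diagonal / anti-diagonal move lowering `max(|x₀|, |x₁|)` by `2`; ground sites have `x₀, x₁` even with
`x₀ + x₁ ≡ 0 (mod 4)`). [folklore] -/
theorem reachable_origin_of_height_zero {k : ℕ} (hk : 2 ≤ k) : ∀ (n : ℕ) (x : diamondFilm k), ((x : diamondSite) : Site 3) 2 = 0 →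
    -(n : ℤ) ≤ ((x : diamondSite) : Site 3) 0 → ((x : diamondSite) : Site 3) 0 ≤ n →
    -(n : ℤ) ≤ ((x : diamondSite) : Site 3) 1 → ((x : diamondSite) : Site 3) 1 ≤ n →
    (diamondGraph.induce (diamondFilm k)).Reachable x (diamondFilmOrigin k) := by
  intro n
  induction n using Nat.strong_induction_on with
  | _ n ih =>
    intro x hx2 hl0 hu0 hl1 hu1
    have hsite := (mem_diamondSite_iff _).1 (x : diamondSite).2
    rw [hx2] at hsite
    by_cases h00 : ((x : diamondSite) : Site 3) 0 = 0 ∧ ((x : diamondSite) : Site 3) 1 = 0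
    · have : x = diamondFilmOrigin k := by
        apply Subtype.ext; apply Subtype.ext
        ext i; fin_cases i
        · exact h00.1
        · exact h00.2
        · exact hx2
      subst this; rfl
    · -- parities: `x₀, x₁` even, `x₀ + x₁ ≡ 0 (mod 4)`
      have hp : ((x : diamondSite) : Site 3) 0 % 2 = 0 ∧ ((x : diamondSite) : Site 3) 1 % 2 = 0 ∧
          (((x : diamondSite) : Site 3) 0 + ((x : diamondSite) : Site 3) 1) % 4 = 0 := by omega
      have hk1 : 1 ≤ k := le_trans (by norm_num) hk
      -- choose the move
      by_cases hA : (0 ≤ ((x : diamondSite) : Site 3) 0 ∧ 0 ≤ ((x : diamondSite) : Site 3) 1) ∨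
          (((x : diamondSite) : Site 3) 0 ≤ 0 ∧ ((x : diamondSite) : Site 3) 1 ≤ 0)
      · -- diagonal move towards the origin
        have hσ : (if 0 ≤ ((x : diamondSite) : Site 3) 0 ∧ 0 ≤ ((x : diamondSite) : Site 3) 1 then (-1 : ℤ) else 1) = 1 ∨
            (if 0 ≤ ((x : diamondSite) : Site 3) 0 ∧ 0 ≤ ((x : diamondSite) : Site 3) 1 then (-1 : ℤ) else 1) = -1 := by
          split_ifs <;> simp
        obtain ⟨z, ⟨hz0, hz1, hz2⟩, hr⟩ := exists_reachable_diag hk1 x hx2 hσ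
        have hn : 2 ≤ n := by omega
        have hz : -((n - 2 : ℕ) : ℤ) ≤ ((z : diamondSite) : Site 3) 0 ∧ ((z : diamondSite) : Site 3) 0 ≤ ((n - 2 : ℕ) : ℤ) ∧
            -((n - 2 : ℕ) : ℤ) ≤ ((z : diamondSite) : Site 3) 1 ∧ ((z : diamondSite) : Site 3) 1 ≤ ((n - 2 : ℕ) : ℤ) := by
          rw [Nat.cast_sub hn]
          split_ifs at hz0 hz1 with hq <;> omega
        exact hr.trans (ih (n - 2) (by omega) z hz2 hz.1 hz.2.1 hz.2.2.1 hz.2.2.2)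
      · -- anti-diagonal move towards the origin (`x₀`, `x₁` of opposite strict signs)
        have hτ : (if 0 < ((x : diamondSite) : Site 3) 0 then (-1 : ℤ) else 1) = 1 ∨
            (if 0 < ((x : diamondSite) : Site 3) 0 then (-1 : ℤ) else 1) = -1 := by
          split_ifs <;> simp
        obtain ⟨z, ⟨hz0, hz1, hz2⟩, hr⟩ := exists_reachable_antidiag hk x hx2 hτ
        have hn : 2 ≤ n := by omega
        have hz : -((n - 2 : ℕ) : ℤ) ≤ ((z : diamondSite) : Site 3) 0 ∧ ((z : diamondSite) : Site 3) 0 ≤ ((n - 2 : ℕ) : ℤ) ∧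
            -((n - 2 : ℕ) : ℤ) ≤ ((z : diamondSite) : Site 3) 1 ∧ ((z : diamondSite) : Site 3) 1 ≤ ((n - 2 : ℕ) : ℤ) := by
          rw [Nat.cast_sub hn]
          split_ifs at hz0 hz1 with hq <;> omega
        exact hr.trans (ih (n - 2) (by omega) z hz2 hz.1 hz.2.1 hz.2.2.1 hz.2.2.2)

/-- **Every vertex of the film is joined to the origin** (`k ≥ 2`). [folklore] -/
theorem reachable_origin {k : ℕ} (hk : 2 ≤ k) (x : diamondFilm k) :
    (diamondGraph.induce (diamondFilm k)).Reachable x (diamondFilmOrigin k) := by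
  have hx := mem_diamondFilm.1 x.2
  obtain ⟨y, hy2, hxy⟩ := exists_reachable_height_zero (((x : diamondSite) : Site 3) 2).toNat x (by omega)
  refine hxy.trans (reachable_origin_of_height_zero hk
    ((((y : diamondSite) : Site 3) 0).natAbs + (((y : diamondSite) : Site 3) 1).natAbs) y hy2 ?_ ?_ ?_ ?_) <;> omega

/-- **The `(001)`-film of the diamond lattice is CONNECTED for every thickness `k ≥ 2`** (the scope record the node was missing,
«StatementObliqueFilms» module doc 'TODO row'; at `k = 1` the film is the disjoint union of the zigzag lines `x₀ − x₁ = const`, at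
`k = 0` it is edgeless). [cite: ConwaySloane1999, Ch. 4 §7.3 (D₃⁺ = diamond)] [cite: BenjaminiSchramm1996, Question 3] -/
theorem connected {k : ℕ} (hk : 2 ≤ k) : (diamondGraph.induce (diamondFilm k)).Connected := by
  haveI : Nonempty (diamondFilm k) := ⟨diamondFilmOrigin k⟩
  exact ⟨fun x y => (reachable_origin hk x).trans (reachable_origin hk y).symm⟩

/-! ## §3 The free cocompact `ℤ²`-action by the translations `(4m, 4n, 0)` and the node for `k ≥ 2` -/

/-- Translation by `(4m, 4n, 0)` preserves the diamond structure (parities and the residue of `x₀ + x₁ + x₂ mod 4`). [folklore] -/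
theorem add_mem_diamondSite (x : diamondSite) (a : Site 2) : (x : Site 3) + ![4 * a 0, 4 * a 1, 0] ∈ diamondSite := by
  obtain ⟨h0, h1, h2⟩ := (mem_diamondSite_iff _).1 x.2
  rw [mem_diamondSite_iff]
  simp only [Pi.add_apply, Matrix.cons_val_zero, Matrix.cons_val_one, Matrix.cons_val_two, Matrix.tail_cons, Matrix.head_cons,
    add_zero]
  omega

/-- … and the height `x₂`, hence the film. [folklore] -/
theorem add_mem_diamondFilm {k : ℕ} (x : diamondFilm k) (a : Site 2) :
    (⟨((x : diamondSite) : Site 3) + ![4 * a 0, 4 * a 1, 0], add_mem_diamondSite _ a⟩ : diamondSite) ∈ diamondFilm k := by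
  have hx := mem_diamondFilm.1 x.2
  rw [mem_diamondFilm]
  simpa using hx

/-- The ground-level vertices with `0 ≤ x₀, x₁ < 4` form a finite set (orbit representatives of the `4ℤ²`-translations). [folklore] -/
theorem finite_reps (k : ℕ) : {x : diamondFilm k | 0 ≤ ((x : diamondSite) : Site 3) 0 ∧ ((x : diamondSite) : Site 3) 0 < 4 ∧
    0 ≤ ((x : diamondSite) : Site 3) 1 ∧ ((x : diamondSite) : Site 3) 1 < 4}.Finite := by
  refine Set.Finite.of_finite_image (f := fun x : diamondFilm k =>
    (((x : diamondSite) : Site 3) 0, ((x : diamondSite) : Site 3) 1, ((x : diamondSite) : Site 3) 2)) ?_ ?_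
  · refine ((Set.finite_Icc (0 : ℤ) 3).prod ((Set.finite_Icc (0 : ℤ) 3).prod (Set.finite_Icc (0 : ℤ) k))).subset ?_
    rintro _ ⟨x, ⟨h0, h0', h1, h1'⟩, rfl⟩
    have hx := mem_diamondFilm.1 x.2
    simp only [Set.mem_prod, Set.mem_Icc]
    omega
  · intro x _ y _ h
    simp only [Prod.mk.injEq] at h
    apply Subtype.ext; apply Subtype.ext
    ext i; fin_cases i
    · exact h.1
    · exact h.2.1
    · exact h.2.2

/-- **The diamond film of every thickness `k ≥ 2` has `p_c < 1` and dies at its own critical point, at every vertex** — from the rung-Q node via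
`AutChart.conj4_zTwoPeriodic_holds`: the translations `x ↦ x + (4m, 4n, 0)` form a free `ℤ²`-action by automorphisms of the film with finitely many
orbits (representatives in the box `[0,4)² × [0,k]`), and the film is connected (§2).  builds on p205010 (kernel theorem, internal audit signed;
external expert review pending). [cite: BenjaminiSchramm1996, Conj. 4 / Question 3; §2] [cite: Kesten1982, Ch. 3 (periodic graphs)] -/
theorem conj4_holds {k : ℕ} (hk : 2 ≤ k) (v : diamondFilm k) :
    criticalProb (diamondGraph.induce (diamondFilm k)) v < 1 ∧
      theta (diamondGraph.induce (diamondFilm k)) v (criticalProbIOf (diamondGraph.induce (diamondFilm k)) v) = 0 := by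
  -- the `ℤ²`-action by the translations `(4m, 4n, 0)` (a local instance; no global instance is declared)
  letI inst : MulAction (Multiplicative (Site 2)) (diamondFilm k) :=
    { smul := fun a x => ⟨⟨((x : diamondSite) : Site 3) + ![4 * Multiplicative.toAdd a 0, 4 * Multiplicative.toAdd a 1, 0],
          add_mem_diamondSite _ _⟩, add_mem_diamondFilm x _⟩
      one_smul := fun x => Subtype.ext (Subtype.ext (by
        change ((x : diamondSite) : Site 3) + _ = ((x : diamondSite) : Site 3)
        funext i
        fin_cases i <;> simp))
      mul_smul := fun a b x => Subtype.ext (Subtype.ext (by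
        change ((x : diamondSite) : Site 3) + _ = (((x : diamondSite) : Site 3) + _) + _
        rw [add_assoc]
        congr 1
        funext i
        fin_cases i <;> simp <;> ring)) }
  have hcoe : ∀ (a : Multiplicative (Site 2)) (x : diamondFilm k), (((a • x : diamondFilm k) : diamondSite) : Site 3) =
      ((x : diamondSite) : Site 3) + ![4 * Multiplicative.toAdd a 0, 4 * Multiplicative.toAdd a 1, 0] :=
    fun a x => rfl
  -- by automorphisms: translations preserve coordinate differences
  have hact : IsActionByAut (diamondGraph.induce (diamondFilm k)) (Multiplicative (Site 2)) := by
    intro a x y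
    change (distSqGraph 3 3).Adj (((x : diamondSite) : Site 3) + _) (((y : diamondSite) : Site 3) + _) ↔
      (distSqGraph 3 3).Adj ((x : diamondSite) : Site 3) ((y : diamondSite) : Site 3)
    simp only [distSqGraph_adj, Pi.add_apply, add_sub_add_right_eq_sub, ne_eq, add_left_inj]
  -- free: a translation `(4m, 4n, 0)` fixing one site is `0`
  have hfree : ∀ (a : Multiplicative (Site 2)) (x : diamondFilm k), a • x = x → a = 1 := by
    intro a x h
    have h' : ((x : diamondSite) : Site 3) + ![4 * Multiplicative.toAdd a 0, 4 * Multiplicative.toAdd a 1, 0] =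
        ((x : diamondSite) : Site 3) := by
      rw [← hcoe]; exact congrArg (fun y : diamondFilm k => ((y : diamondSite) : Site 3)) h
    rw [add_eq_left] at h'
    have h0 := congrFun h' 0
    have h1 := congrFun h' 1
    simp only [Matrix.cons_val_zero, Matrix.cons_val_one, Pi.zero_apply] at h0 h1
    refine Multiplicative.toAdd.injective ?_
    rw [toAdd_one]
    funext i
    fin_cases i
    · show Multiplicative.toAdd a 0 = 0; omega
    · show Multiplicative.toAdd a 1 = 0; omega
  -- finitely many orbits: representatives in the box `0 ≤ x₀, x₁ < 4`
  have hcover : ∀ w : diamondFilm k, ∃ a : Multiplicative (Site 2), ∃ r ∈ (finite_reps k).toFinset, a • r = w := by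
    intro w
    set q0 : ℤ := ((w : diamondSite) : Site 3) 0 / 4 with hq0
    set q1 : ℤ := ((w : diamondSite) : Site 3) 1 / 4 with hq1
    -- the representative `r = w − (4 q₀, 4 q₁, 0)`
    let r : diamondFilm k := (Multiplicative.ofAdd ![-q0, -q1]) • w
    have hr : (((r : diamondFilm k) : diamondSite) : Site 3) = ((w : diamondSite) : Site 3) + ![4 * -q0, 4 * -q1, 0] := by
      rw [hcoe, toAdd_ofAdd]; rfl
    refine ⟨Multiplicative.ofAdd ![q0, q1], r, ?_, ?_⟩
    · rw [Set.Finite.mem_toFinset, Set.mem_setOf_eq, hr]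
      simp only [Pi.add_apply, Matrix.cons_val_zero, Matrix.cons_val_one]
      omega
    · apply Subtype.ext; apply Subtype.ext
      rw [hcoe, hr, toAdd_ofAdd, add_assoc]
      conv_rhs => rw [← add_zero ((w : diamondSite) : Site 3)]
      congr 1
      funext i
      fin_cases i <;> simp
  exact AutChart.conj4_zTwoPeriodic_holds hact hfree (connected hk) (finite_reps k).toFinset hcover v

/-- **`p_c < 1` on the diamond film of every thickness `k ≥ 2`, at every vertex.** builds on p205010 (kernel theorem, internal audit signed;
external expert review pending). [cite: BenjaminiSchramm1996, Thm. 1 / §2] -/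
theorem criticalProb_lt_one {k : ℕ} (hk : 2 ≤ k) (v : diamondFilm k) : criticalProb (diamondGraph.induce (diamondFilm k)) v < 1 :=
  (conj4_holds hk v).1

/-! ### Thickness `0`: the edgeless film (bookkeeping case of the node) -/

/-- The film of thickness `0` (the single layer `x₂ = 0`) has no edges: a diamond bond moves `x₂` by `±1`. [folklore] -/
theorem not_adj_of_zero (x y : diamondFilm 0) : ¬ (diamondGraph.induce (diamondFilm 0)).Adj x y := fun h => by
  have hx := mem_diamondFilm.1 x.2
  have hy := mem_diamondFilm.1 y.2
  have h2 := diamond_abs_sub_eq_one (x := (x : diamondSite)) (y := (y : diamondSite)) h 2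
  simp only [Nat.cast_zero] at hx hy
  rw [show ((x : diamondSite) : Site 3) 2 = 0 by omega, show ((y : diamondSite) : Site 3) 2 = 0 by omega] at h2
  simp at h2

/-- On the edgeless film of thickness `0`, `θ_v(p) = 0` at every vertex and every `p`. [folklore] -/
theorem theta_of_zero (v : diamondFilm 0) (p : unitInterval) : theta (diamondGraph.induce (diamondFilm 0)) v p = 0 :=
  theta_eq_zero_of_degree_le (diamondGraph.induce (diamondFilm 0)) (D := 0)
    (fun w => Nat.le_zero.2 (Finset.card_eq_zero.2 (Finset.eq_empty_of_forall_notMem fun u hu =>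
      not_adj_of_zero w u ((SimpleGraph.mem_neighborFinset _ _ _).1 hu))))
    v p (by simp)

end DiamondFilm

/-! ## §4 The nodes by name -/

/-- **TARGET 2x, diamond conjunct, for `k ≥ 2`: `DiamondFilmOwnCriticalContinuity k`** — the `(001)`-film of the diamond lattice of thickness
`k ≥ 2` dies at its own critical point at every vertex («StatementObliqueFilms» :50, literal type).  From the rung-Q node («SkelFrmQuasiProxHoldsAll»)
via the doubly-periodic customer `AutChart.conj4_zTwoPeriodic_holds`; no Trofimov / growth / named-fact hypothesis.  (`k = 1` is 2-regular and
disconnected — excluded by the target; `k = 0` is edgeless: `diamondFilmOwnCriticalContinuity_zero`.)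
builds on p205010 (kernel theorem, internal audit signed; external expert review pending). [cite: BenjaminiSchramm1996, Conj. 4 / Question 3]
[cite: ConwaySloane1999, Ch. 4 §7.3] -/
theorem diamondFilmOwnCriticalContinuity_holds {k : ℕ} (hk : 2 ≤ k) : DiamondFilmOwnCriticalContinuity k :=
  fun v => (DiamondFilm.conj4_holds hk v).2

/-- The bookkeeping case `k = 0` of the diamond node (edgeless film: `θ ≡ 0`). [folklore] -/
theorem diamondFilmOwnCriticalContinuity_zero : DiamondFilmOwnCriticalContinuity 0 :=
  fun v => DiamondFilm.theta_of_zero v _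

/-- **TARGET 2x BY NAME, UNCONDITIONAL: `ObliqueFilmOwnCriticalContinuity`** — (i) every `(111)`-film of `ℤ³` of thickness `k ≥ 1` and (ii) every
`(001)`-film of the diamond lattice of thickness `k ≥ 2` dies at its OWN critical point at every vertex («StatementObliqueFilms» :56, postcont-2
Targets §gen-51 TARGET 2x).  Both conjuncts are customers of the rung-Q node through `AutChart.conj4_zTwoPeriodic_holds` (free cocompact `ℤ²`-actions
by translations): (i) «Slab111OwnCriticalContinuityHolds» `slab111OwnCriticalContinuity_holds`, (ii) `diamondFilmOwnCriticalContinuity_holds`.  In print: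
the honeycomb film ((i), `k = 1`; Kesten 1982) and the diamond `k = 2` film (a decorated square lattice, Harris–Kesten by an exact substitution); OPEN in
print before this file: (i) for `k ≥ 2` and (ii) for `k ≥ 3`.  No Trofimov / growth / named-fact hypothesis.
builds on p205010 (kernel theorem, internal audit signed; external expert review pending).
[cite: BenjaminiSchramm1996, Conj. 4 / Question 3] [cite: DuminilCopinSidoraviciusTassion2016, p. 3 "Two generalizations" (not covered there)] -/
theorem obliqueFilmOwnCriticalContinuity_holds : ObliqueFilmOwnCriticalContinuity :=
  ⟨fun k _ => slab111OwnCriticalContinuity_holds k, fun _ hk => diamondFilmOwnCriticalContinuity_holds hk⟩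

end Summit.CriticalPhenomena.PercolationContinuityZ3.Theorems.Transplant

end
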